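import Summits.BirchSwinnertonDyer.Rank1Residual.X2.NonsplitBDPValueDisplayPNew
import Summits.BirchSwinnertonDyer.Rank1Residual.X11b.ChaRoute
import Literature.NumberTheory.EllipticCurves.BDPValueContinuityMultiplicativePrime
import HarnessLib

/-!
# The two typings of Castella JIMJ18 Thms. 2.10–2.11 AGREE on classical Heegner data: bsd-eis's
# `thm210_thm211_bdpDisplay_pNew` (BDP's display, kernel-rescaled) IMPLIES bsd-stepL's
# `castella2018Exceptional_bdpValueContinuity_trivialChar` there (Castella's display, docstring dictionary)

Cell `bsd-stepL` (run/shared/lean/pub/bsd-stepL/), seat `bsd-stepL-bdp` (prover g11, 2026-08-26),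
`--supports stmt-BirchSwinnertonDyer-19275`. CONSISTENCY CERTIFICATE for the referee (PROOF-BDP §28,
ask R28-2 «the fact's dictionary flag»). On 2026-08-26 two cells typed the same printed theorems
(Castella, J. Inst. Math. Jussieu 17 (2018), Thms. 2.10–2.11 at weight two) within minutes of each other:

* bsd-eis (k5-c4, 09:39Z): `Castella2018Exceptional.thm210_thm211_bdpDisplay_pNew` — BDP 2013's OWN
  display (`bdpLp` with the printed constants `C(f,χ,1)`, `w(f,χ)`, `(𝔟, b_N)`), STRICT Heegner hypothesis
  (`SatisfiesHeegnerHypothesis`: every `ℓ ∣ N` split), and the rescaling to Castella's display done IN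
  THE KERNEL (`X2.PNewDisplay.eulerSq_mul_bdpLalg_eq`, `X2.continuousDisplay_pNew_of_bdpDisplay`);
* bsd-stepL (bdp g11, 09:22Z): `castella2018Exceptional_bdpValueContinuity_trivialChar` — Castella's
  display directly (value continuity at `𝟙`), BDP13's GENERAL Heegner hypothesis (ramified `q ∥ N`
  allowed, with the auxiliary sign clause «`q ∣ (N, d_K)` ⇒ non-split multiplicative»), the BDP→Castella
  dictionary carried in the docstring (flag `JIMJ18-VC-dictionary-via-Cas18`).

THIS FILE (theorems only): on the common domain — classical Heegner data, `p ≥ 5` multiplicative —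
the bsd-eis fact IMPLIES the bsd-stepL fact's conclusion VERBATIM
(`bdpValueContinuity_on_heegnerData_of_pNew`), through bsd-eis's kernel rescaling. So the docstring
dictionary of the bsd-stepL fact is KERNEL-CHECKED wherever the bsd-eis fact applies; what the
bsd-stepL fact adds beyond it is exactly the ramified-`q` (erratum-data) extension, i.e. BDP13 §4.1's
`S(f) ≠ ∅` case with the constant `2^{#S(f)}` (an odd-`p` unit, already a parameter of `bdpLp`) and the
sign clause (PROOF-BDP §28 LEMMA VN.6, calibrated by kit j253100). Nothing is booked; no label moves (T7).
-/

set_option autoImplicit false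

noncomputable section

open scoped Classical Topology
open Filter WeierstrassCurve NumberField IsDedekindDomain Field
open Literature.NumberTheory.EllipticCurves Literature.NumberTheory.EllipticCurves.ModularForms
open Literature.NumberTheory.EllipticCurves.Rank1Residual
open Literature.NumberTheory.EllipticCurves.Castella2018
open Literature.NumberTheory.EllipticCurves.Castella2018Exceptional
open Literature.NumberTheory.GaloisRepresentations
open Summit.BirchSwinnertonDyer.Rank1Residual Summit.BirchSwinnertonDyer.Rank1Residual.X11b

namespace Summit.BirchSwinnertonDyer.BirchSwinnertonDyer.Theorems

/-- **bsd-eis's fact ⟹ bsd-stepL's fact on classical Heegner data.** For `W/ℚ` globally minimal of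
conductor `N` with `p ≥ 5` multiplicative, `K` imaginary quadratic with `d_K` odd, `p` split, `𝔭 ∋ p`
compatible with `ι`, the STRICT Heegner hypothesis `SatisfiesHeegnerHypothesis N K`, a parametrisation
datum with `p ∤ c`, the Heegner point `P`, `e` inducing `𝔭`, `κ` anticyclotomic with generator `γ`:
the conclusion of `castella2018Exceptional_bdpValueContinuity_trivialChar` (virtual periods, a norm-one
`u`, displays → `u·((1 − a_p p⁻¹)·log_{ω_E} P)²` along every interpolation sequence through `κ`) follows
from `thm210_thm211_bdpDisplay_pNew` by bsd-eis's `X2.continuousDisplay_pNew_of_bdpDisplay` (exact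
rescaling of BDP's display, `p ∤ w_K·d_K·2`). The binders `d_K < −3` and the sign clause of the
bsd-stepL fact are not needed here (strict Heegner: `S(f) = ∅`). CONDITIONAL on the bsd-eis fact.
[cite: Castella2018Exceptional, Thms. 2.10–2.11 (arXiv:1507.04260 pp. 13–14)]
[cite: BertoliniDarmonPrasanna2013, Thm. 4.6, (5.1.11), (5.2.4), Prop. 5.10] -/
theorem bdpValueContinuity_on_heegnerData_of_pNew (hB : thm210_thm211_bdpDisplay_pNew)
    {p : ℕ} [Fact p.Prime] (ι : PadicAlgCl p ≃+* ℂ) (W : WeierstrassCurve ℚ) [W.IsElliptic]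
    [W.IsGloballyMinimal] (K : Type) [Field K] [NumberField K] (𝔭 : HeightOneSpectrum (𝓞 K))
    (κ : ZpExtension K p) (γ : absoluteGaloisGroup K) {N : ℕ} [NeZero N]
    (Dt : ModularParametrizationData W N) (H : HeegnerDatum N (NumberField.discr K))
    (w : InfinitePlace K) (e : K →+* ℚ_[p]) (P : (W.baseChange K).toAffine.Point)
    (h5 : 5 ≤ p) (hN : W.conductorNorm ℤ = N) (hmult : W.HasMultiplicativeReductionAtPrime p)
    (hK : IsImaginaryQuadratic K) (hodd : Odd (NumberField.discr K))
    (hsplit : ((Ideal.span {(p : ℤ)}).primesOver (𝓞 K)).ncard = 2)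
    (h𝔭 : ((p : ℕ) : 𝓞 K) ∈ 𝔭.asIdeal)
    (hcompat : ∀ (w' : InfinitePlace K) (k : 𝓞 K),
      k ∈ 𝔭.asIdeal ↔ ‖ι.symm (w'.embedding (k : K))‖ < 1)
    (hH : SatisfiesHeegnerHypothesis N K) (hκ : κ.IsAnticyclotomic) (hγ : κ.IsTopGenerator γ)
    (hc : ¬ (p : ℤ) ∣ Dt.c)
    (hP : WeierstrassCurve.Affine.Point.map w.embedding.toRatAlgHom P = heegnerPointComplex Dt H)
    (he : ∀ k : 𝓞 K, k ∈ 𝔭.asIdeal ↔ ‖e (k : K)‖ < 1) :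
    ∃ (ΩK : ℂ) (Ωp : ℂ_[p]) (u : ℂ_[p]), ΩK ≠ 0 ∧ Ωp ≠ 0 ∧ ‖u‖ = 1 ∧
      ∀ (φ : ℕ → HeckeCharacter K) (n : ℕ → ℕ) (r : ℕ → FramedGaloisRep K (PadicAlgCl p) 1),
        (∀ k, 0 < n k) → (∀ k (v : HeightOneSpectrum (𝓞 K)), (φ k).IsUnramifiedAt v) →
        (∀ k, (φ k).HasInfinityType (fun _ ↦ (n k : ℤ)) (fun _ ↦ -(n k : ℤ))) →
        (∀ k, IsPAdicAvatarOf ι (φ k) (r k)) → (∀ k, FactorsThroughZp κ (r k)) →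
        Tendsto (fun k ↦ avatarValueAt (r k) γ) atTop (𝓝 1) →
        Tendsto (fun k ↦ ((ι.symm (bdpInterpolationValue p Dt.f 𝔭 (φ k) (n k) ΩK) : PadicAlgCl p) :
            ℂ_[p]) * Ωp ^ (4 * n k)) atTop
          (𝓝 (u * (algebraMap ℚ_[p] ℂ_[p] (((1 : ℚ_[p]) - (W.LFunction p : ℚ_[p]) * (p : ℚ_[p])⁻¹) *
            Castella2018.padicLogOmega W p e P)) ^ 2)) := by
  have hpN' : p ∣ W.conductorNorm ℤ := dvd_conductorNorm_of_mult hmult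
  have hp2N' : ¬ p ^ 2 ∣ W.conductorNorm ℤ := not_sq_dvd_conductorNorm_of_mult W p hmult
  rw [hN] at hpN' hp2N'
  obtain ⟨ΩK, Ωp, u, hΩK, hΩp, hu, hcont⟩ := X2.continuousDisplay_pNew_of_bdpDisplay hB ι W K 𝔭 κ γ
    Dt H w e P h5 hN hpN' hp2N' hK hodd hsplit h𝔭 hcompat hH hκ hγ hc hP he
  exact ⟨ΩK, Ωp, u, hΩK, hΩp, hu, hcont⟩

/-- **Hence, on classical Heegner data, the bsd-stepL fact is a COROLLARY of the bsd-eis fact**: every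
instance of `castella2018Exceptional_bdpValueContinuity_trivialChar`'s binder list that in addition
satisfies `SatisfiesHeegnerHypothesis N K` is delivered by `thm210_thm211_bdpDisplay_pNew` (the extra
binders `d_K < −3`, the degree-one clause and the sign clause are simply not used). The bsd-stepL
fact's own content beyond this is the ramified-`q` (erratum-data) case. [folklore] -/
theorem bdpValueContinuity_binders_on_heegnerData_of_pNew (hB : thm210_thm211_bdpDisplay_pNew)
    {p : ℕ} [Fact p.Prime] (ι : PadicAlgCl p ≃+* ℂ) (W : WeierstrassCurve ℚ) [W.IsElliptic]
    [W.IsGloballyMinimal] (K : Type) [Field K] [NumberField K] (𝔭 : HeightOneSpectrum (𝓞 K))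
    (κ : ZpExtension K p) (γ : absoluteGaloisGroup K) {N : ℕ} [NeZero N]
    (Dt : ModularParametrizationData W N) (H : HeegnerDatum N (NumberField.discr K))
    (w : InfinitePlace K) (e : K →+* ℚ_[p]) (P : (W.baseChange K).toAffine.Point)
    (h5 : 5 ≤ p) (hN : W.conductorNorm ℤ = N) (hmult : W.HasMultiplicativeReductionAtPrime p)
    (hK : IsImaginaryQuadratic K) (hodd : Odd (NumberField.discr K))
    (_h3 : NumberField.discr K < -3)
    (hsplit : ((Ideal.span {(p : ℤ)}).primesOver (𝓞 K)).ncard = 2)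
    (h𝔭 : ((p : ℕ) : 𝓞 K) ∈ 𝔭.asIdeal)
    (hcompat : ∀ (w' : InfinitePlace K) (k : 𝓞 K),
      k ∈ 𝔭.asIdeal ↔ ‖ι.symm (w'.embedding (k : K))‖ < 1)
    (_hHeeg : ∀ ℓ : ℕ, ℓ.Prime → ℓ ∣ N → ∃ v : HeightOneSpectrum (𝓞 K), Ideal.absNorm v.asIdeal = ℓ)
    (_hsign : ∀ (ℓ : ℕ) [Fact ℓ.Prime], ℓ ∣ N → (ℓ : ℤ) ∣ NumberField.discr K →
      W.HasMultiplicativeReductionAtPrime ℓ ∧ ¬ W.HasSplitMultiplicativeReductionAtPrime ℓ)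
    (hκ : κ.IsAnticyclotomic) (hγ : κ.IsTopGenerator γ) (hc : ¬ (p : ℤ) ∣ Dt.c)
    (hP : WeierstrassCurve.Affine.Point.map w.embedding.toRatAlgHom P = heegnerPointComplex Dt H)
    (he : ∀ k : 𝓞 K, k ∈ 𝔭.asIdeal ↔ ‖e (k : K)‖ < 1) (hH : SatisfiesHeegnerHypothesis N K) :
    ∃ (ΩK : ℂ) (Ωp : ℂ_[p]) (u : ℂ_[p]), ΩK ≠ 0 ∧ Ωp ≠ 0 ∧ ‖u‖ = 1 ∧
      ∀ (φ : ℕ → HeckeCharacter K) (n : ℕ → ℕ) (r : ℕ → FramedGaloisRep K (PadicAlgCl p) 1),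
        (∀ k, 0 < n k) → (∀ k (v : HeightOneSpectrum (𝓞 K)), (φ k).IsUnramifiedAt v) →
        (∀ k, (φ k).HasInfinityType (fun _ ↦ (n k : ℤ)) (fun _ ↦ -(n k : ℤ))) →
        (∀ k, IsPAdicAvatarOf ι (φ k) (r k)) → (∀ k, FactorsThroughZp κ (r k)) →
        Tendsto (fun k ↦ avatarValueAt (r k) γ) atTop (𝓝 1) →
        Tendsto (fun k ↦ ((ι.symm (bdpInterpolationValue p Dt.f 𝔭 (φ k) (n k) ΩK) : PadicAlgCl p) :
            ℂ_[p]) * Ωp ^ (4 * n k)) atTop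
          (𝓝 (u * (algebraMap ℚ_[p] ℂ_[p] (((1 : ℚ_[p]) - (W.LFunction p : ℚ_[p]) * (p : ℚ_[p])⁻¹) *
            Castella2018.padicLogOmega W p e P)) ^ 2)) :=
  bdpValueContinuity_on_heegnerData_of_pNew hB ι W K 𝔭 κ γ Dt H w e P h5 hN hmult hK hodd hsplit h𝔭
    hcompat hH hκ hγ hc hP he

end Summit.BirchSwinnertonDyer.BirchSwinnertonDyer.Theorems

end
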